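import Mathlib
import HarnessLib
import Summits.ValiantsHypothesis.ValiantsHypothesis.Theorems.MonotoneRestorationOrbitRestorationQPColumnGrouped

/-!
# Column-grouped families, parity form: partial products with an even sign class are narrow

Route MonotoneRestoration, crux `OrbitRestorationQP` (stmt-ValiantsHypothesis-18293), SPAN-currency lane of the open
sub-rung A_∞ (`stub_sigmaPiSigmaValue`), `ΠΣ` part.  Helper (`--supports`), def-free.  Companion of
`SuperAtoms.prod_mem_narrowSpan_of_colGrouped` for SUB-families:

* **`prod_mem_narrowSpan_of_colGrouped_of_even`** — `G_i ≠ 0` row-atom polynomials (column cores `≤ c₀`, `2c₀ < n`),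
  rows rescale each `G_i`, columns transport up to units along permutations, column-untwisted, and the SIGN CLASS
  (members not fixed by all row renamings) has even cardinality ⇒ `Π_i G_i ∈ span_ℂ {hom_{F,n} : tw F ≤ 2c₀ + 1}`.

Use: the column-label groupings of ONE orbit type of blocks of a matrix-symmetric affine product form a column-stable
sub-family whose product is only relatively invariant; this form lets the next hand treat orbit types one at a time
(column side for the types whose column groupings are untwisted, row side — by `…TransposeSpan.lean` — for the others).
No registered stub is closed; the crux and VP ≠ VNP are not moved. [folklore; cite: DwivediPagoSeppelt2026, §8]
-/

noncomputable section

-- `Summit.ValiantsHypothesis.ValiantsHypothesis.…` is the tree's single-conjunct layout (Sub = Summit).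
set_option linter.dupNamespace false

namespace Summit.ValiantsHypothesis.ValiantsHypothesis.Theorems

namespace SuperAtoms

open MvPolynomial Finset Equiv
open Literature.Computability.AlgebraicComplexity (homPoly)
open Literature.Combinatorics.SimpleGraph (treewidth)

variable {n : ℕ}

/-- **COLUMN-GROUPED PARTIAL PRODUCTS ARE NARROW (parity form).**  As `prod_mem_narrowSpan_of_colGrouped`, but the
row-invariance of the product is replaced by its consequence actually used: the number of members that are NOT
row-invariant (the sign class) is even.  This is the form that applies to a column-stable SUB-family of the groupings of
a matrix-symmetric affine product (e.g. the groupings of one orbit type), whose product is only relatively invariant.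
[folklore; cite: DwivediPagoSeppelt2026, §8; Weyl1939, Chap. II §3; Macdonald1995, §I.2] -/
theorem prod_mem_narrowSpan_of_colGrouped_of_even (c₀ : ℕ) (hc₀ : 2 * c₀ < n) {ι : Type} [Fintype ι]
    (G : ι → MvPolynomial (Fin n × Fin n) ℂ) (hG0 : ∀ i, G i ≠ 0)
    (hloc : ∀ i, ∃ (c : ℕ) (ψ : Fin c → Fin n) (P : MvPolynomial (Fin n × (Fin c ⊕ Unit)) ℂ), c ≤ c₀ ∧
      G i = aeval (fun w : Fin n × (Fin c ⊕ Unit) =>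
        Sum.elim (fun b : Fin c => (X (w.1, ψ b) : MvPolynomial (Fin n × Fin n) ℂ))
          (fun _ : Unit => ∑ j : Fin n, (X (w.1, j) : MvPolynomial (Fin n × Fin n) ℂ)) w.2) P)
    (hrow : ∀ (σ : Perm (Fin n)) (i : ι), ∃ u : ℂ, rename (fun P : Fin n × Fin n => (σ P.1, P.2)) (G i) = C u * G i)
    (hcol : ∀ τ : Perm (Fin n), ∃ κ : Perm ι, ∀ i, ∃ u : ℂ, u ≠ 0 ∧
      rename (fun P : Fin n × Fin n => (P.1, τ P.2)) (G i) = C u * G (κ i))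
    (hcolfree : ∀ (τ : Perm (Fin n)) (i : ι) (u : ℂ),
      rename (fun P : Fin n × Fin n => (P.1, τ P.2)) (G i) = C u * G i → u = 1)
    (hpar : Even (Fintype.card {i // ¬ ∀ σ : Perm (Fin n), rename (fun P : Fin n × Fin n => (σ P.1, P.2)) (G i) = G i})) :
    (∏ i, G i) ∈ Submodule.span ℂ {p : MvPolynomial (Fin n × Fin n) ℂ |
        ∃ (a b : ℕ) (E : Multiset (Fin a × Fin b)),
          treewidth (SimpleGraph.fromRel fun u v : Fin a ⊕ Fin b =>
            ∃ e ∈ E, u = Sum.inl e.1 ∧ v = Sum.inr e.2) ≤ 2 * c₀ + 1 ∧ p = homPoly E n ℂ} := by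
  classical
  -- row multipliers
  choose v hv using hrow
  have hvclass : ∀ i, (∀ σ, v σ i = 1) ∨ (∀ σ, v σ i = ((Equiv.Perm.sign σ : ℤˣ) : ℤ)) :=
    fun i => rowMultiplier_eq_one_or_sign (hG0 i) (fun σ => v σ i) (fun σ => hv σ i)
  have hvsq : ∀ σ i, v σ i * v σ i = 1 := by
    intro σ i
    rcases hvclass i with h | h
    · rw [h, one_mul]
    · rw [h, ← Int.cast_mul, ← Units.val_mul, Int.units_mul_self, Units.val_one, Int.cast_one]
  -- column normalisation
  choose κ hκ using hcol
  obtain ⟨d, hd0, hexact⟩ := exists_rescaling_exactly_colPermuted G hG0 κ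
    (fun τ i => hκ τ i) hcolfree
  set G' : ι → MvPolynomial (Fin n × Fin n) ℂ := fun i => C (d i) * G i with hG'
  have hG'0 : ∀ i, G' i ≠ 0 := fun i => mul_ne_zero (by rw [Ne, C_eq_zero]; exact hd0 i) (hG0 i)
  have hv' : ∀ σ i, rename (fun P : Fin n × Fin n => (σ P.1, P.2)) (G' i) = C (v σ i) * G' i := by
    intro σ i
    simp only [hG', map_mul, rename_C, hv]
    ring
  have hloc' : ∀ i, ∃ (c : ℕ) (ψ : Fin c → Fin n) (P : MvPolynomial (Fin n × (Fin c ⊕ Unit)) ℂ), c ≤ c₀ ∧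
      G' i = aeval (fun w : Fin n × (Fin c ⊕ Unit) =>
        Sum.elim (fun b : Fin c => (X (w.1, ψ b) : MvPolynomial (Fin n × Fin n) ℂ))
          (fun _ : Unit => ∑ j : Fin n, (X (w.1, j) : MvPolynomial (Fin n × Fin n) ℂ)) w.2) P := by
    intro i
    obtain ⟨c, ψ, P, hc, hP⟩ := hloc i
    refine ⟨c, ψ, C (d i) * P, hc, ?_⟩
    rw [map_mul, algHom_C, algebraMap_eq, ← hP]
  -- the two row classes; exact column transport preserves them
  set p : ι → Prop := fun i => ∀ σ, v σ i = 1 with hp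
  have hsign : ∀ i, ¬ p i → ∀ σ, v σ i = ((Equiv.Perm.sign σ : ℤˣ) : ℤ) := by
    intro i hi
    rcases hvclass i with h | h
    · exact absurd h hi
    · exact h
  have hpres : ∀ (τ : Perm (Fin n)) (κ' : Perm ι),
      (∀ i, rename (fun P : Fin n × Fin n => (P.1, τ P.2)) (G' i) = G' (κ' i)) → ∀ i, p (κ' i) ↔ p i := by
    intro τ κ' h i
    have hvv : ∀ σ, v σ i = v σ (κ' i) := fun σ =>
      rowMultiplier_eq_of_colTransport (hG'0 (κ' i)) (fun σ => v σ i) (fun σ => v σ (κ' i))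
        (fun σ => hv' σ i) (fun σ => hv' σ (κ' i)) one_ne_zero (by rw [C_1, one_mul, h i]) σ
    simp only [hp, hvv]
  -- the two sub-families
  have hcol₁ : ∀ τ : Perm (Fin n), ∃ κ₁ : Perm {i // p i}, ∀ i : {i // p i},
      rename (fun P : Fin n × Fin n => (P.1, τ P.2)) (G' i) = G' (κ₁ i) := by
    intro τ
    obtain ⟨κ', hκ'⟩ := hexact τ
    refine ⟨κ'.subtypePerm (hpres τ κ' hκ'), fun i => ?_⟩
    rw [Equiv.Perm.subtypePerm_apply]
    exact hκ' i
  have hcol₂ : ∀ τ : Perm (Fin n), ∃ κ₂ : Perm {i // ¬ p i}, ∀ i : {i // ¬ p i},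
      rename (fun P : Fin n × Fin n => (P.1, τ P.2)) (G' i) = G' (κ₂ i) := by
    intro τ
    obtain ⟨κ', hκ'⟩ := hexact τ
    refine ⟨κ'.subtypePerm (fun i => not_congr (hpres τ κ' hκ' i)), fun i => ?_⟩
    rw [Equiv.Perm.subtypePerm_apply]
    exact hκ' i
  have h₁ : (∏ i : {i // p i}, G' i) ∈ Submodule.span ℂ {q : MvPolynomial (Fin n × Fin n) ℂ |
        ∃ (a b : ℕ) (E : Multiset (Fin a × Fin b)),
          treewidth (SimpleGraph.fromRel fun u v : Fin a ⊕ Fin b =>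
            ∃ e ∈ E, u = Sum.inl e.1 ∧ v = Sum.inr e.2) ≤ 2 * c₀ + 1 ∧ q = homPoly E n ℂ} := by
    refine (Submodule.span_mono ?_) (prod_mem_narrowSpan_of_rowInvariant_rowAtomFactors n c₀ (by omega)
      (fun i : {i // p i} => G' i) (fun σ i => ?_) hcol₁ (fun i => hloc' i))
    · rintro q ⟨a, b, E, hE, rfl⟩
      exact ⟨a, b, E, hE.trans (by omega), rfl⟩
    · rw [hv', i.2 σ, C_1, one_mul]
  -- parity of the sign class
  have hprodG' : (∏ i, G' i) = C (∏ i, d i) * ∏ i, G i := by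
    simp only [hG', Finset.prod_mul_distrib, map_prod]
  have hsplit := (Fintype.prod_subtype_mul_prod_subtype p G').symm
  have heven : Even (Fintype.card {i // ¬ p i}) := by
    have hiff : ∀ i, (¬ ∀ σ : Perm (Fin n), rename (fun P : Fin n × Fin n => (σ P.1, P.2)) (G i) = G i) ↔ ¬ p i := by
      intro i
      refine not_congr ⟨fun h σ => ?_, fun h σ => ?_⟩
      · apply scalar_eq_of_mul_eq (hG0 i)
        rw [← hv, h σ, C_1, one_mul]
      · rw [hv, h σ, C_1, one_mul]
    rwa [Fintype.card_congr (Equiv.subtypeEquivRight hiff)] at hpar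
  have h₂ : (∏ i : {i // ¬ p i}, G' i) ∈ Submodule.span ℂ {q : MvPolynomial (Fin n × Fin n) ℂ |
        ∃ (a b : ℕ) (E : Multiset (Fin a × Fin b)),
          treewidth (SimpleGraph.fromRel fun u v : Fin a ⊕ Fin b =>
            ∃ e ∈ E, u = Sum.inl e.1 ∧ v = Sum.inr e.2) ≤ 2 * c₀ + 1 ∧ q = homPoly E n ℂ} :=
    prod_mem_narrowSpan_of_signStable_rowAtomFactors n c₀ hc₀ heven (fun i : {i // ¬ p i} => G' i)
      (fun σ => (((Equiv.Perm.sign σ : ℤˣ) : ℤ) : ℂ))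
      (fun σ => by rw [← Int.cast_mul, ← Units.val_mul, Int.units_mul_self, Units.val_one, Int.cast_one])
      (fun σ i => by rw [hv', hsign i i.2 σ]) hcol₂ (fun i => hloc' i)
  -- assemble
  have hd : (∏ i, d i) ≠ 0 := Finset.prod_ne_zero_iff.2 fun i _ => hd0 i
  have hGG : (∏ i, G i) = (∏ i, d i)⁻¹ • ((∏ i : {i // p i}, G' i) * ∏ i : {i // ¬ p i}, G' i) := by
    rw [← hsplit, hprodG', smul_eq_C_mul, ← mul_assoc, ← map_mul, inv_mul_cancel₀ hd, C_1, one_mul]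
  rw [hGG]
  exact Submodule.smul_mem _ _ (NarrowSpanAlgebra.narrowSpan_mul_mem n (2 * c₀ + 1) h₁ h₂)

end SuperAtoms

end Summit.ValiantsHypothesis.ValiantsHypothesis.Theorems

end
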